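import Literature.Analysis.FunctionSpaces.PlancherelL1L2
import Literature.Analysis.FunctionSpaces.L2ValuedPathDeriv
import Mathlib.MeasureTheory.Group.Prod
import Mathlib.MeasureTheory.Group.Integral
import Mathlib.MeasureTheory.Integral.MeanInequalities
import HarnessLib

/-!
# Plancherel in advanced time for a source paired against an outgoing principal wave

Analysis/Fourier support file (theorem-only). The `1+1`-dimensional MODEL LEMMA behind the treatment of far
sources in the frequency-localised energy estimates on black-hole backgrounds (Dafermos–Rodnianski–
Shlapentokh-Rothman, arXiv:1402.7034, §5.2.2 and §9.6: the inhomogeneous term of the cut-off wave equation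
paired against the outgoing solution `u_out ∼ e^{iωr*}`; "a wave train of radial extent `w` has bandwidth `1/w`").
For a source `f(t, y)` (time `t`, tortoise radius `y`; values in a complex Hilbert space `F`, e.g. `L²(S²)`):

* `Literature.Analysis.Fourier.fourier_outgoingTrace_eq` — **the Jost principal pairing is a Fourier transform in
  advanced time `v = t + y`**: with Mathlib's convention `𝓕g(ξ) = ∫ e^{-2πiξt} g(t) dt` (so the physical
  frequency is `ω = -2πξ` and the outgoing phase `e^{iωy}` is `e^{-2πiyξ}`),
  `𝓕[v ↦ ∫ f(v - y, y) dy](ξ) = ∫ e^{-2πiyξ} • 𝓕[f(·, y)](ξ) dy` for `f ∈ L¹(ℝ²)` (Fubini + translation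
  invariance);
* `Literature.Analysis.Fourier.lintegral_enorm_sq_outgoingTrace_le` — **the advanced-time trace costs no
  weights**: if every section `y ↦ f(v - y, y)` along an ingoing null line `t + y = v` is supported on a set
  of measure `≤ L`, then `∫ ‖∫ f(v - y, y) dy‖² dv ≤ L · ∫∫ ‖f‖²` (Cauchy–Schwarz on the sections, Tonelli and
  the measure-preserving shear `(v, y) ↦ (v - y, y)`);
* `Literature.Analysis.Fourier.lintegral_enorm_sq_outgoingPairing_le` — **the model inequality**: for
  `f ∈ L¹(ℝ²)` (finite right-hand side iff `f ∈ L²` or `L = 0`) with sections of measure `≤ L`,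
  `∫ ‖∫ e^{-2πiyξ} • 𝓕[f(·, y)](ξ) dy‖² dξ ≤ L · ∫∫ ‖f(t, y)‖² dt dy`
  (the two items above and Plancherel on `L¹ ∩ L²`, `Literature.Analysis.FunctionSpaces.lintegral_enorm_sq_fourierIntegral_eq`).

In the application the source of the time cut-off `ξ(τ)ψ` lives on the slab `0 ≤ t - Φ(y) ≤ 1` between two
leaves of a graph time function; along `t + y = v` the slab has `y`-extent `≤ L` as soon as `y ↦ y + Φ(y)` has
slope `≥ 1/L`, so the far source enters the estimates through its UNWEIGHTED space-time `L²` norm (a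
finite-in-time energy), whereas an `L¹(dy)` bound at fixed frequency would lose the radial extent of the source.

## Mathlib search

`MeasureTheory.measurePreserving_sub_prod` (the shear), `MeasureTheory.integral_integral_swap`,
`MeasureTheory.integral_add_right_eq_self`, `ENNReal.lintegral_mul_le_Lp_mul_Lq` (Hölder),
`MeasureTheory.lintegral_prod`, `Real.fourier_real_eq_integral_exp_smul`; Plancherel for `L¹ ∩ L²` is the tree's
`Literature/Analysis/FunctionSpaces/PlancherelL1L2.lean`. No statement about sheared traces / advanced-time
Plancherel exists.

## References

* M. Dafermos, I. Rodnianski, Y. Shlapentokh-Rothman, *Decay for solutions of the wave equation on Kerr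
  exterior spacetimes III*, arXiv:1402.7034, §5.2.2, §9.6. [DafermosRodnianskiShlapentokhrothman2014]
-/

noncomputable section

open MeasureTheory FourierTransform Complex Set Filter Real
open scoped ENNReal Topology

namespace Literature.Analysis.Fourier

section Trace

variable {F : Type*} [NormedAddCommGroup F] [NormedSpace ℝ F]

/-! ### The shear `(v, y) ↦ (v - y, y)` and the advanced-time trace -/

omit [NormedSpace ℝ F] in
/-- Integrability of the sheared source `(v, y) ↦ f(v - y, y)`. [folklore] -/
theorem integrable_shear {f : ℝ × ℝ → F} (hf : Integrable f (volume.prod volume)) :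
    Integrable (fun z : ℝ × ℝ ↦ f (z.1 - z.2, z.2)) (volume.prod volume) :=
  (measurePreserving_sub_prod (volume : Measure ℝ) (volume : Measure ℝ)).integrable_comp_of_integrable hf

/-- **Cauchy–Schwarz on one section**: if `g` vanishes off a set of measure `≤ L`, then
`‖∫ g‖ₑ² ≤ L · ∫ ‖g‖ₑ²`. [folklore] -/
theorem enorm_integral_sq_le_of_measure_support_le {g : ℝ → F} (hg : StronglyMeasurable g) {L : ℝ≥0∞}
    (hL : volume {y | g y ≠ 0} ≤ L) :
    ‖∫ y, g y‖ₑ ^ 2 ≤ L * ∫⁻ y, ‖g y‖ₑ ^ 2 := by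
  set S : Set ℝ := {y | g y ≠ 0} with hS
  have hsupp : (fun y ↦ ‖g y‖ₑ).support ⊆ S := fun y hy ↦ by
    simp only [Function.mem_support, ne_eq, enorm_eq_zero] at hy
    exact hy
  have hmeas : AEMeasurable (fun y ↦ ‖g y‖ₑ) (volume.restrict S) := hg.enorm.aemeasurable
  -- `‖∫ g‖ₑ ≤ ∫⁻_S ‖g‖ₑ ≤ (∫⁻_S ‖g‖ₑ²)^{1/2} (μ S)^{1/2}`
  have h1 : ‖∫ y, g y‖ₑ ≤ ∫⁻ y in S, ‖g y‖ₑ := by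
    rw [setLIntegral_eq_of_support_subset hsupp]
    exact enorm_integral_le_lintegral_enorm _
  have h2 : ∫⁻ y in S, ‖g y‖ₑ ≤
      (∫⁻ y in S, ‖g y‖ₑ ^ (2 : ℝ)) ^ (1 / (2 : ℝ)) *
        (∫⁻ _y in S, (1 : ℝ≥0∞) ^ (2 : ℝ)) ^ (1 / (2 : ℝ)) := by
    have h := ENNReal.lintegral_mul_le_Lp_mul_Lq (volume.restrict S) Real.HolderConjugate.two_two hmeas
      aemeasurable_const (f := fun y ↦ ‖g y‖ₑ) (g := fun _ ↦ (1 : ℝ≥0∞))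
    simpa only [Pi.mul_apply, mul_one] using h
  have h3 : (∫⁻ _y in S, (1 : ℝ≥0∞) ^ (2 : ℝ)) = volume S := by
    simp only [ENNReal.one_rpow, lintegral_const, Measure.restrict_apply_univ, one_mul]
  have h4 : ∫⁻ y in S, ‖g y‖ₑ ^ (2 : ℝ) ≤ ∫⁻ y, ‖g y‖ₑ ^ 2 := by
    calc ∫⁻ y in S, ‖g y‖ₑ ^ (2 : ℝ) ≤ ∫⁻ y, ‖g y‖ₑ ^ (2 : ℝ) := setLIntegral_le_lintegral S _
      _ = ∫⁻ y, ‖g y‖ₑ ^ 2 := by simp_rw [ENNReal.rpow_two]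
  calc ‖∫ y, g y‖ₑ ^ 2
      ≤ ((∫⁻ y in S, ‖g y‖ₑ ^ (2 : ℝ)) ^ (1 / (2 : ℝ)) * (volume S) ^ (1 / (2 : ℝ))) ^ 2 := by
        rw [← h3]; gcongr; exact h1.trans h2
    _ = (∫⁻ y in S, ‖g y‖ₑ ^ (2 : ℝ)) * volume S := by
        rw [mul_pow, ← ENNReal.rpow_two, ← ENNReal.rpow_two, ← ENNReal.rpow_mul, ← ENNReal.rpow_mul]
        norm_num
    _ ≤ (∫⁻ y, ‖g y‖ₑ ^ 2) * L := mul_le_mul' h4 hL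
    _ = L * ∫⁻ y, ‖g y‖ₑ ^ 2 := mul_comm _ _

/-- **The advanced-time trace costs no weights** (strongly measurable version): if every section
`y ↦ f(v - y, y)` vanishes off a set of measure `≤ L`, then `∫ ‖∫ f(v - y, y) dy‖ₑ² dv ≤ L · ∫∫ ‖f‖ₑ²`.
[cite: DafermosRodnianskiShlapentokhrothman2014, §9.6] -/
theorem lintegral_enorm_sq_outgoingTrace_le_of_stronglyMeasurable {f : ℝ × ℝ → F}
    (hf : StronglyMeasurable f) {L : ℝ≥0∞} (hL : ∀ᵐ v : ℝ, volume {y : ℝ | f (v - y, y) ≠ 0} ≤ L) :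
    ∫⁻ v, ‖∫ y, f (v - y, y)‖ₑ ^ 2 ≤ L * ∫⁻ z, ‖f z‖ₑ ^ 2 ∂(volume.prod volume) := by
  have hsh : Measurable fun z : ℝ × ℝ ↦ (z.1 - z.2, z.2) :=
    (measurable_fst.sub measurable_snd).prodMk measurable_snd
  have hg : StronglyMeasurable fun z : ℝ × ℝ ↦ f (z.1 - z.2, z.2) := hf.comp_measurable hsh
  -- pointwise Cauchy–Schwarz on a.e. section
  have hpt : ∀ᵐ v : ℝ, ‖∫ y, f (v - y, y)‖ₑ ^ 2 ≤ L * ∫⁻ y, ‖f (v - y, y)‖ₑ ^ 2 := by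
    filter_upwards [hL] with v hv
    exact enorm_integral_sq_le_of_measure_support_le
      (hg.comp_measurable (measurable_const.prodMk measurable_id)) hv
  have hmeas2 : Measurable fun z : ℝ × ℝ ↦ ‖f (z.1 - z.2, z.2)‖ₑ ^ 2 := hg.enorm.pow_const _
  have hmeasf : Measurable fun z : ℝ × ℝ ↦ ‖f z‖ₑ ^ 2 := hf.enorm.pow_const _
  have hshear : ∫⁻ z, ‖f (z.1 - z.2, z.2)‖ₑ ^ 2 ∂(volume.prod volume) =
      ∫⁻ z, ‖f z‖ₑ ^ 2 ∂(volume.prod volume) :=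
    (measurePreserving_sub_prod (volume : Measure ℝ) (volume : Measure ℝ)).lintegral_comp
      (f := fun z : ℝ × ℝ ↦ ‖f z‖ₑ ^ 2) hmeasf
  calc ∫⁻ v, ‖∫ y, f (v - y, y)‖ₑ ^ 2
      ≤ ∫⁻ v, L * ∫⁻ y, ‖f (v - y, y)‖ₑ ^ 2 := lintegral_mono_ae hpt
    _ = L * ∫⁻ v, ∫⁻ y, ‖f (v - y, y)‖ₑ ^ 2 := by
        rw [lintegral_const_mul'' _ (hmeas2.lintegral_prod_right').aemeasurable]
    _ = L * ∫⁻ z, ‖f (z.1 - z.2, z.2)‖ₑ ^ 2 ∂(volume.prod volume) := by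
        rw [lintegral_prod _ hmeas2.aemeasurable]
    _ = L * ∫⁻ z, ‖f z‖ₑ ^ 2 ∂(volume.prod volume) := by rw [hshear]

/-- **The advanced-time trace costs no weights**: for a.e.-strongly measurable `f` on `ℝ²` whose sections
`y ↦ f(v - y, y)` vanish off sets of measure `≤ L` (a.e. `v`),
`∫ ‖∫ f(v - y, y) dy‖ₑ² dv ≤ L · ∫∫ ‖f‖ₑ²`. [cite: DafermosRodnianskiShlapentokhrothman2014, §9.6] -/
theorem lintegral_enorm_sq_outgoingTrace_le {f : ℝ × ℝ → F}
    (hf : AEStronglyMeasurable f (volume.prod volume)) {L : ℝ≥0∞}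
    (hL : ∀ᵐ v : ℝ, volume {y : ℝ | f (v - y, y) ≠ 0} ≤ L) :
    ∫⁻ v, ‖∫ y, f (v - y, y)‖ₑ ^ 2 ≤ L * ∫⁻ z, ‖f z‖ₑ ^ 2 ∂(volume.prod volume) := by
  -- pass to a strongly measurable representative `f'`; the shear is measure preserving, so
  -- `f ∘ shear = f' ∘ shear` a.e., hence a.e. on a.e. section
  set f' := hf.mk f with hf'
  have hff' : f =ᵐ[volume.prod volume] f' := hf.ae_eq_mk
  have hsh := measurePreserving_sub_prod (volume : Measure ℝ) (volume : Measure ℝ)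
  have hcomp : (fun z : ℝ × ℝ ↦ f (z.1 - z.2, z.2)) =ᵐ[volume.prod volume]
      fun z : ℝ × ℝ ↦ f' (z.1 - z.2, z.2) :=
    hsh.quasiMeasurePreserving.ae_eq_comp hff'
  have hsec : ∀ᵐ v : ℝ, (fun y ↦ f (v - y, y)) =ᵐ[volume] fun y ↦ f' (v - y, y) :=
    Measure.ae_ae_of_ae_prod hcomp
  have hL' : ∀ᵐ v : ℝ, volume {y : ℝ | f' (v - y, y) ≠ 0} ≤ L := by
    filter_upwards [hL, hsec] with v hv hv'
    refine le_trans (measure_mono_ae ?_) hv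
    filter_upwards [hv'] with y hy
    intro (h : f' (v - y, y) ≠ 0)
    show f (v - y, y) ≠ 0
    rwa [hy]
  have hint : ∀ᵐ v : ℝ, ∫ y, f (v - y, y) = ∫ y, f' (v - y, y) := by
    filter_upwards [hsec] with v hv using integral_congr_ae hv
  calc ∫⁻ v, ‖∫ y, f (v - y, y)‖ₑ ^ 2 = ∫⁻ v, ‖∫ y, f' (v - y, y)‖ₑ ^ 2 :=
        lintegral_congr_ae (hint.mono fun v hv ↦ by simp only [hv])
    _ ≤ L * ∫⁻ z, ‖f' z‖ₑ ^ 2 ∂(volume.prod volume) :=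
        lintegral_enorm_sq_outgoingTrace_le_of_stronglyMeasurable hf.stronglyMeasurable_mk hL'
    _ = L * ∫⁻ z, ‖f z‖ₑ ^ 2 ∂(volume.prod volume) := by
        congr 1
        exact lintegral_congr_ae (hff'.mono fun z hz ↦ by simp only [hz])

end Trace

section Fourier

variable {F : Type*} [NormedAddCommGroup F] [InnerProductSpace ℂ F] [CompleteSpace F]

/-! ### The pairing with the outgoing phase is a Fourier transform in advanced time -/

omit [CompleteSpace F] in
/-- **The Jost principal pairing is a Fourier transform in advanced time**: for `f ∈ L¹(ℝ²)` and every `ξ`,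
`𝓕[v ↦ ∫ f(v - y, y) dy](ξ) = ∫ e^{-2πiyξ} • 𝓕[t ↦ f(t, y)](ξ) dy`.
[cite: DafermosRodnianskiShlapentokhrothman2014, §9.6] -/
theorem fourier_outgoingTrace_eq {f : ℝ × ℝ → F} (hf : Integrable f (volume.prod volume)) (ξ : ℝ) :
    𝓕 (fun v ↦ ∫ y, f (v - y, y)) ξ =
      ∫ y, Complex.exp (↑(-2 * π * y * ξ) * Complex.I) • 𝓕 (fun t ↦ f (t, y)) ξ := by
  have hg := integrable_shear (F := F) hf
  -- the phase
  have hec : Continuous fun v : ℝ ↦ Complex.exp (↑(-2 * π * v * ξ) * Complex.I) := by fun_prop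
  have hn1 : ∀ v : ℝ, ‖Complex.exp (↑(-2 * π * v * ξ) * Complex.I)‖ = 1 := fun v ↦
    Complex.norm_exp_ofReal_mul_I _
  have hmul : ∀ t y : ℝ, Complex.exp (↑(-2 * π * (t + y) * ξ) * Complex.I) =
      Complex.exp (↑(-2 * π * y * ξ) * Complex.I) * Complex.exp (↑(-2 * π * t * ξ) * Complex.I) := by
    intro t y
    rw [← Complex.exp_add]
    congr 1
    push_cast
    ring
  have hge : Integrable (Function.uncurry fun v y : ℝ ↦
      Complex.exp (↑(-2 * π * v * ξ) * Complex.I) • f (v - y, y)) (volume.prod volume) := by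
    refine hg.norm.mono' ((hec.comp continuous_fst).aestronglyMeasurable.smul hg.aestronglyMeasurable)
      (ae_of_all _ fun z ↦ ?_)
    obtain ⟨v, y⟩ := z
    simp only [Function.uncurry_apply_pair]
    rw [norm_smul, hn1, one_mul]
  rw [Real.fourier_real_eq_integral_exp_smul]
  calc ∫ v, Complex.exp (↑(-2 * π * v * ξ) * Complex.I) • ∫ y, f (v - y, y)
      = ∫ v, ∫ y, Complex.exp (↑(-2 * π * v * ξ) * Complex.I) • f (v - y, y) := by
        congr 1
        funext v
        exact (integral_smul _ _).symm
    _ = ∫ y, ∫ v, Complex.exp (↑(-2 * π * v * ξ) * Complex.I) • f (v - y, y) :=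
        integral_integral_swap hge
    _ = ∫ y, ∫ t, Complex.exp (↑(-2 * π * (t + y) * ξ) * Complex.I) • f (t, y) := by
        congr 1
        funext y
        rw [← integral_add_right_eq_self
          (fun v ↦ Complex.exp (↑(-2 * π * v * ξ) * Complex.I) • f (v - y, y)) y]
        simp only [add_sub_cancel_right]
    _ = ∫ y, Complex.exp (↑(-2 * π * y * ξ) * Complex.I) •
          ∫ t, Complex.exp (↑(-2 * π * t * ξ) * Complex.I) • f (t, y) := by
        congr 1
        funext y
        rw [← integral_smul]
        congr 1
        funext t
        rw [smul_smul, hmul]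
    _ = ∫ y, Complex.exp (↑(-2 * π * y * ξ) * Complex.I) • 𝓕 (fun t ↦ f (t, y)) ξ := by
        congr 1
        funext y
        rw [Real.fourier_real_eq_integral_exp_smul]

/-! ### The model inequality -/

/-- **Plancherel in advanced time for a source paired against an outgoing principal wave** (the `1+1` model
lemma of DRSR §9.6): for `f ∈ L¹(ℝ²; F)` (the bound is of interest for `f ∈ L¹ ∩ L²`) whose sections `y ↦ f(v - y, y)` along the ingoing null lines
`t + y = v` vanish off sets of measure `≤ L` (a.e. `v`),
`∫ ‖∫ e^{-2πiyξ} • 𝓕[t ↦ f(t, y)](ξ) dy‖ₑ² dξ ≤ L · ∫∫ ‖f(t, y)‖ₑ² dt dy`: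
the square of the pairing of the time-Fourier transform of the source with the outgoing phase `e^{iωy}`,
`ω = -2πξ`, integrated over ALL frequencies without weights, is controlled by the UNWEIGHTED space-time `L²`
norm of the source. [cite: DafermosRodnianskiShlapentokhrothman2014, §9.6] -/
theorem lintegral_enorm_sq_outgoingPairing_le {f : ℝ × ℝ → F} (h1 : Integrable f (volume.prod volume))
    {L : ℝ≥0∞}
    (hL : ∀ᵐ v : ℝ, volume {y : ℝ | f (v - y, y) ≠ 0} ≤ L) :
    ∫⁻ ξ, ‖∫ y, Complex.exp (↑(-2 * π * y * ξ) * Complex.I) • 𝓕 (fun t ↦ f (t, y)) ξ‖ₑ ^ 2 ≤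
      L * ∫⁻ z, ‖f z‖ₑ ^ 2 ∂(volume.prod volume) := by
  -- the advanced-time trace `G`
  set G : ℝ → F := fun v ↦ ∫ y, f (v - y, y) with hG
  have hGi : Integrable G := (integrable_shear h1).integral_prod_left
  have hGb : ∫⁻ v, ‖G v‖ₑ ^ 2 ≤ L * ∫⁻ z, ‖f z‖ₑ ^ 2 ∂(volume.prod volume) :=
    lintegral_enorm_sq_outgoingTrace_le h1.aestronglyMeasurable hL
  have hF : ∀ ξ, 𝓕 G ξ = ∫ y, Complex.exp (↑(-2 * π * y * ξ) * Complex.I) • 𝓕 (fun t ↦ f (t, y)) ξ :=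
    fourier_outgoingTrace_eq h1
  simp_rw [← hF]
  by_cases htop : L * ∫⁻ z, ‖f z‖ₑ ^ 2 ∂(volume.prod volume) = ∞
  · rw [htop]; exact le_top
  -- `G ∈ L²`, so Plancherel applies
  have hG2 : MemLp G 2 (volume : Measure ℝ) := by
    refine ⟨hGi.aestronglyMeasurable, ?_⟩
    have hlt : ∫⁻ v, ‖G v‖ₑ ^ 2 < ∞ := hGb.trans_lt (lt_top_iff_ne_top.2 htop)
    rw [Literature.Analysis.FunctionSpaces.lintegral_enorm_sq_eq_eLpNorm_sq] at hlt
    refine lt_top_iff_ne_top.2 fun h ↦ ?_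
    rw [h, ENNReal.top_pow two_ne_zero] at hlt
    exact lt_irrefl _ hlt
  calc ∫⁻ ξ, ‖𝓕 G ξ‖ₑ ^ 2 = ∫⁻ v, ‖G v‖ₑ ^ 2 :=
        Literature.Analysis.FunctionSpaces.lintegral_enorm_sq_fourierIntegral_eq hGi hG2
    _ ≤ L * ∫⁻ z, ‖f z‖ₑ ^ 2 ∂(volume.prod volume) := hGb

end Fourier

end Literature.Analysis.Fourier
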